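import Literature.GroupTheory.ArithmeticGroups.NeatSubgroups
import Literature.GroupTheory.ArithmeticGroups.SelbergLemma
import Mathlib.RingTheory.Ideal.GoingUp
import Mathlib.FieldTheory.IsAlgClosed.AlgebraicClosure
import HarnessLib

/-!
# Selberg's lemma, neat form (Borel 1969, 17.7): a finitely generated subgroup of `GL_n(K)`, `char K = 0`, has a NEAT subgroup of finite index

Family `hodge` (arithmetic quotients `Γ\D` of period domains and ball quotients are taken at neat
level), layer `Literature/GroupTheory/ArithmeticGroups`; theorems only (no definition, no named
fact; D-0026). Sequel of `SelbergLemma.lean` (MALCEV–SELBERG, torsion-free form, after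
[Serre2007BoundsFiniteSubgroups, Lect. I §1.2]: "NOT here: «net» subgroups … only torsion-freeness
is formalised") and of `NeatSubgroups.lean` (BOREL's neatness, [Borel1969, §17.1, Prop. 17.4]).

**Statement formalised** ([Borel1969, §17, Proposition 17.7, p. 119], as quoted in
[SilverbergZarhin1996, §1, p. 286]): "A different variation on Minkowski's theorem, due to Selberg,
says that if `K` is a field of characteristic zero and `H` is a finitely generated subgroup of
`GL_n(K)`, then `H` has a net (and therefore torsionfree) subgroup of finite index (see 17.7 on
p. 119 of [Borel 1969])." Serre's sketch ([Serre2007BoundsFiniteSubgroups, Lect. I §1.2, Remark]: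
"a nice consequence of lemma 1′ is the following result of Malcev and Selberg ([Bo 69], §17) …") is
followed word for word, with Lemma 1′ replaced by the eigenvalue computation below:

* `Γ ⊂ GL_n(L₀)` for a finitely generated subring `L₀ ⊂ K` (`SelbergLemma`'s
  `exists_fg_subalgebra_le_range`); a maximal ideal `𝔪` of `L₀` has finite residue field of some
  characteristic `p` (`finite_quotient_of_isMaximal`), and there is a prime `𝔮` with finite residue
  ring of characteristic `q ≠ p` (`exists_ideal_isPrime_finite_quotient_ringChar_ne`);
* ENGINE (`eq_of_orderOf_eq_prime_of_mem_eigenvalueSubgroup`): if `x ∈ M_n(A)` is `≡ 1 (mod P)` for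
  a prime `P` of a domain `A ⊂ L` with `p ∈ P`, then every element of PRIME order `ℓ` of the
  eigenvalue group `E_L(x)` has `ℓ = p`. Proof: in the integral closure `S` of `A` in `L` pick a
  prime `𝔓 ⊇ P·S` (`P·S ≠ S` by integrality, Mathlib's `Ideal.map_eq_top_iff`); the eigenvalues
  `λ` of `x` lie in `S` and `λ ≡ 1 (mod 𝔓)` because `λ - 1` is a root of `charpoly(x - 1)`, whose
  non-leading coefficients lie in `P` (`Matrix.coeff_charpoly_mem_ideal_pow`); hence every element
  of `E_L(x)` is a quotient `a/b` with `a ≡ b ≡ 1 (mod 𝔓)` (closure induction); a root of unity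
  `ζ = a/b` of prime order `ℓ` then has `1 - ζ ∈ 𝔓`, so `ℓ = Φ_ℓ(1) = ∏ (1 - ζ^i) ∈ 𝔓`; as
  `p ∈ 𝔓` too, `ℓ = p` (distinct primes are coprime);
* the kernels `Δ_𝔪`, `Δ_𝔮` of `Γ → GL_n(L₀/𝔪)`, `Γ → GL_n(L₀/𝔮)` have finite index, and for
  `g ∈ Δ_𝔪 ∩ Δ_𝔮` an element of prime order `ℓ` of `E_L(g)` would have `ℓ = p` and `ℓ = q` — so
  `E_L(g)` is torsion-free, i.e. `g` is NEAT, for every field `L ⊇ K`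
  (`Subgroup.exists_finiteIndex_neat_of_fg`, `Subgroup.exists_le_finiteIndex_neat_of_fg`).

By `NeatSubgroups`' `IsNeat.eq_one_of_pow_eq_one` ("a neat subgroup is also torsion free") this
refines `SelbergLemma`'s `Subgroup.exists_finiteIndex_torsionFree_of_fg`, which is not restated.

## References

* [Borel1969] A. Borel, Introduction aux groupes arithmétiques, Hermann (1969), §17, Prop. 17.7
  (p. 119).
* [SilverbergZarhin1996] A. Silverberg, Yu. G. Zarhin, Variations on a theme of Minkowski and Serre,
  JPAA 111 (1996), §1 p. 286 (quotation of Borel 17.7).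
* [Serre2007BoundsFiniteSubgroups] J.-P. Serre, Bounds for the orders of the finite subgroups of
  `G(k)`, Lecture I §1.2, Remark (Malcev–Selberg).
-/

open scoped MatrixGroups

namespace Literature.GroupTheory.ArithmeticGroups

open Polynomial

universe uL

/-! ### §1 The engine: eigenvalues of `x ≡ 1 (mod P)` modulo a prime of the integral closure -/

section Engine

variable {A : Type*} [CommRing A] [IsDomain A] {L : Type*} [Field L] [Algebra A L]
variable {n : Type*} [Fintype n] [DecidableEq n]

/-- The eigenvalues `λ ∈ L` of a matrix `x ∈ M_n(A)` with `x ≡ 1 (mod P)` are integral over `A` and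
satisfy `λ ≡ 1 (mod 𝔓)` for every prime `𝔓` of the integral closure of `A` in `L` containing `P`:
`λ - 1` is a root of `charpoly(x - 1) = X^n + c₁X^{n-1} + ⋯ + c_n` with `cᵢ ∈ P`, so
`(λ - 1)^n ∈ 𝔓`. [folklore] -/
private theorem exists_isIntegral_sub_one_mem {P : Ideal A} {x : Matrix n n A}
    (hx : ∀ i j, (x - 1) i j ∈ P) (𝔓 : Ideal (integralClosure A L)) [h𝔓 : 𝔓.IsPrime]
    (hP𝔓 : P.map (algebraMap A (integralClosure A L)) ≤ 𝔓) {μ : L}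
    (hμ : (x.charpoly.map (algebraMap A L)).IsRoot μ) :
    ∃ hμi : IsIntegral A μ,
      (⟨μ, (mem_integralClosure_iff A L).2 hμi⟩ : integralClosure A L) - 1 ∈ 𝔓 := by
  have hμi : IsIntegral A μ :=
    ⟨x.charpoly, x.charpoly_monic, by rw [← Polynomial.eval_map]; exact hμ.eq_zero⟩
  refine ⟨hμi, ?_⟩
  set N : Matrix n n A := x - 1 with hN
  set d := Fintype.card n with hd
  -- `μ - 1` is a root of `charpoly N`
  have hroot : (N.charpoly.map (algebraMap A L)).eval (μ - 1) = 0 := by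
    have h := hμ.eq_zero
    rw [← Matrix.charpoly_map, Matrix.eval_charpoly] at h ⊢
    have hmap : N.map (algebraMap A L) = x.map (algebraMap A L) - 1 := by
      rw [hN, ← RingHom.mapMatrix_apply, map_sub, map_one, RingHom.mapMatrix_apply]
    rwa [hmap, map_sub, map_one, sub_sub_sub_cancel_right]
  -- the non-leading coefficients of `charpoly N` lie in `P`
  have hcoef : ∀ k < d, N.charpoly.coeff k ∈ P := fun k hk =>
    Ideal.pow_le_self (by omega) (Matrix.coeff_charpoly_mem_ideal_pow hx k)
  have hdeg : (N.charpoly.map (algebraMap A L)).natDegree = d := by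
    rw [N.charpoly_monic.natDegree_map, Matrix.charpoly_natDegree_eq_dim]
  have hlead : (N.charpoly.map (algebraMap A L)).coeff d = 1 := by
    have h := (N.charpoly_monic.map (algebraMap A L)).coeff_natDegree
    rwa [hdeg] at h
  -- `(μ - 1)^d + Σ_{k<d} c_k (μ - 1)^k = 0` in `L`
  rw [Polynomial.eval_eq_sum_range, hdeg, Finset.sum_range_succ, hlead, one_mul] at hroot
  simp only [Polynomial.coeff_map] at hroot
  -- the same identity in `S`
  set μ' : integralClosure A L :=
    (⟨μ, (mem_integralClosure_iff A L).2 hμi⟩ : integralClosure A L) - 1 with hμ'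
  set s : integralClosure A L :=
    ∑ k ∈ Finset.range d, algebraMap A (integralClosure A L) (N.charpoly.coeff k) * μ' ^ k with hs
  have hsmem : s ∈ 𝔓 := Ideal.sum_mem _ fun k hk =>
    Ideal.mul_mem_right _ _ (hP𝔓 (Ideal.mem_map_of_mem _ (hcoef k (Finset.mem_range.1 hk))))
  have hsum : s + μ' ^ d = 0 := by
    apply Subtype.val_injective
    simp only [hs, hμ', AddMemClass.coe_add, SubmonoidClass.coe_pow, AddSubmonoidClass.coe_finsetSum,
      MulMemClass.coe_mul, Subalgebra.coe_algebraMap, AddSubgroupClass.coe_sub, OneMemClass.coe_one,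
      ZeroMemClass.coe_zero]
    exact hroot
  have hpow : μ' ^ d ∈ 𝔓 := by
    rw [eq_neg_of_add_eq_zero_right hsum]
    exact 𝔓.neg_mem hsmem
  exact h𝔓.mem_of_pow_mem d hpow

/-- **Closure induction**: every element `u` of the eigenvalue group `E_L(x)` of a matrix
`x ≡ 1 (mod P)` is a quotient `u = a/b` of elements of the integral closure `S` of `A` in `L` with
`a ≡ b ≡ 1 (mod 𝔓)`, for every prime `𝔓 ⊇ P·S` of `S`. [folklore] -/
private theorem exists_mul_eq_of_mem_eigenvalueSubgroup {P : Ideal A} {x : Matrix n n A}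
    (hx : ∀ i j, (x - 1) i j ∈ P) (𝔓 : Ideal (integralClosure A L)) [𝔓.IsPrime]
    (hP𝔓 : P.map (algebraMap A (integralClosure A L)) ≤ 𝔓) {u : Lˣ}
    (hu : u ∈ eigenvalueSubgroup L x) :
    ∃ a b : integralClosure A L, a - 1 ∈ 𝔓 ∧ b - 1 ∈ 𝔓 ∧ (u : L) * (b : L) = (a : L) := by
  rw [mem_eigenvalueSubgroup_iff] at hu
  induction hu using Subgroup.closure_induction with
  | mem v hv =>
    rw [Set.mem_setOf_eq, Polynomial.mem_roots ((x.charpoly_monic.map _).ne_zero)] at hv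
    obtain ⟨hvi, hv1⟩ := exists_isIntegral_sub_one_mem hx 𝔓 hP𝔓 hv
    exact ⟨⟨(v : L), (mem_integralClosure_iff A L).2 hvi⟩, 1, hv1, by simp, by simp⟩
  | one => exact ⟨1, 1, by simp, by simp, by simp⟩
  | mul v w _ _ ihv ihw =>
    obtain ⟨a, b, ha, hb, e⟩ := ihv
    obtain ⟨a', b', ha', hb', e'⟩ := ihw
    refine ⟨a * a', b * b', ?_, ?_, ?_⟩
    · have : a * a' - 1 = (a - 1) * a' + (a' - 1) := by ring
      rw [this]
      exact 𝔓.add_mem (𝔓.mul_mem_right _ ha) ha'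
    · have : b * b' - 1 = (b - 1) * b' + (b' - 1) := by ring
      rw [this]
      exact 𝔓.add_mem (𝔓.mul_mem_right _ hb) hb'
    · rw [Units.val_mul, MulMemClass.coe_mul, MulMemClass.coe_mul, mul_mul_mul_comm, e, e']
  | inv v _ ih =>
    obtain ⟨a, b, ha, hb, e⟩ := ih
    refine ⟨b, a, hb, ha, ?_⟩
    rw [Units.val_inv_eq_inv_val, ← e, inv_mul_cancel_left₀ v.ne_zero]

/-- **The engine.** Let `A ⊂ L` be a domain in a field, `P` a prime ideal of `A` containing the
rational prime `p`, and `x ∈ M_n(A)` with `x ≡ 1 (mod P)`. Then every element of PRIME order `ℓ`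
of the eigenvalue group `E_L(x)` (`NeatSubgroups.eigenvalueSubgroup`) has `ℓ = p`: modulo a prime
`𝔓 ⊇ P` of the integral closure of `A` in `L`, such an element `ζ` is `≡ 1`, so
`ℓ = Φ_ℓ(1) = ∏ (1 - ζ^i) ∈ 𝔓 ∋ p`. (Replaces "by lemma 1′ … `Γ₁` does not have any torsion except
possibly `p`-torsion" of Serre's sketch at the level of eigenvalue groups.)
[cite: Borel1969, §17 Prop. 17.7] [cite: Serre2007BoundsFiniteSubgroups, Lect. I §1.2, Remark] -/
theorem eq_of_orderOf_eq_prime_of_mem_eigenvalueSubgroup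
    (hinj : Function.Injective (algebraMap A L)) (P : Ideal A) [hP : P.IsPrime] {p : ℕ}
    (hp : p.Prime) (hpP : (p : A) ∈ P) {x : Matrix n n A} (hx : ∀ i j, (x - 1) i j ∈ P)
    {u : Lˣ} (hu : u ∈ eigenvalueSubgroup L x) {ℓ : ℕ} (hℓ : ℓ.Prime) (hord : orderOf u = ℓ) :
    ℓ = p := by
  classical
  -- a prime `𝔓 ⊇ P·S` of the integral closure `S` of `A` in `L` (lying over, via integrality)
  have hinjS : Function.Injective (algebraMap A (integralClosure A L)) := fun a b hab =>
    hinj (by simpa [Subalgebra.coe_algebraMap] using congr_arg Subtype.val hab)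
  have hint : (algebraMap A (integralClosure A L)).IsIntegral := fun s =>
    Algebra.IsIntegral.isIntegral s
  have hne : P.map (algebraMap A (integralClosure A L)) ≠ ⊤ := fun h =>
    hP.ne_top ((Ideal.map_eq_top_iff _ hinjS hint).1 h)
  obtain ⟨𝔓, h𝔓max, hP𝔓⟩ := Ideal.exists_le_maximal _ hne
  haveI := h𝔓max
  -- `u = a/b` with `a ≡ b ≡ 1 (mod 𝔓)`
  obtain ⟨a, b, ha, hb, e⟩ := exists_mul_eq_of_mem_eigenvalueSubgroup hx 𝔓 hP𝔓 hu
  -- `ζ = ↑u`, a primitive `ℓ`-th root of unity, lies in `S` and is `≡ 1 (mod 𝔓)`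
  have hζ : IsPrimitiveRoot (u : L) ℓ := by
    have h := IsPrimitiveRoot.orderOf u
    rw [hord] at h
    exact IsPrimitiveRoot.coe_units_iff.2 h
  have hζint : IsIntegral A (u : L) :=
    ⟨X ^ ℓ - 1, monic_X_pow_sub_C 1 hℓ.ne_zero, by simp [hζ.pow_eq_one]⟩
  set ζ' : integralClosure A L := ⟨(u : L), (mem_integralClosure_iff A L).2 hζint⟩ with hζ'def
  have hζ' : IsPrimitiveRoot ζ' ℓ :=
    IsPrimitiveRoot.of_map_of_injective (f := (integralClosure A L).val) (by exact hζ)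
      Subtype.val_injective
  have h1 : 1 - ζ' ∈ 𝔓 := by
    have e' : ζ' * b = a := Subtype.ext (by exact e)
    have : 1 - ζ' = -(a - 1) + ζ' * (b - 1) := by rw [← e']; ring
    rw [this]
    exact 𝔓.add_mem (𝔓.neg_mem ha) (𝔓.mul_mem_left _ hb)
  -- `ℓ = Φ_ℓ(1) = ∏ (1 - μ)` over the primitive `ℓ`-th roots `μ = ζ'^i`, all `≡ 1 (mod 𝔓)`
  have hℓmem : (ℓ : integralClosure A L) ∈ 𝔓 := by
    haveI := Fact.mk hℓ
    have h := Polynomial.eval_one_cyclotomic_prime (R := integralClosure A L) (p := ℓ)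
    rw [Polynomial.cyclotomic_eq_prod_X_sub_primitiveRoots hζ', Polynomial.eval_prod] at h
    simp only [eval_sub, eval_X, eval_C] at h
    rw [← h, ← Finset.mul_prod_erase _ _ ((mem_primitiveRoots hℓ.pos).2 hζ')]
    exact 𝔓.mul_mem_right _ h1
  have hpmem : (p : integralClosure A L) ∈ 𝔓 := by
    have h := Ideal.mem_map_of_mem (algebraMap A (integralClosure A L)) hpP
    rw [map_natCast] at h
    exact hP𝔓 h
  by_contra hne'
  obtain ⟨c, d, hcd⟩ := Nat.Coprime.cast (R := integralClosure A L) ((Nat.coprime_primes hℓ hp).2 hne')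
  exact h𝔓max.ne_top ((Ideal.eq_top_iff_one _).2
    (hcd ▸ 𝔓.add_mem (𝔓.mul_mem_left _ hℓmem) (𝔓.mul_mem_left _ hpmem)))

end Engine

/-! ### §2 A group without elements of prime order in its eigenvalue groups is neat -/

/-- A subgroup without elements of prime order is torsion-free. [folklore] -/
private theorem torsionFree_of_forall_orderOf_ne {G : Type*} [Group G] (H : Subgroup G)
    (h : ∀ v ∈ H, ∀ ℓ : ℕ, ℓ.Prime → orderOf v ≠ ℓ) : ∀ u ∈ H, IsOfFinOrder u → u = 1 := by
  intro u hu hfin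
  by_contra hne
  have hord : orderOf u ≠ 0 := (orderOf_pos_iff.2 hfin).ne'
  obtain ⟨ℓ, hℓ, hdvd⟩ := Nat.exists_prime_and_dvd (fun h1 => hne (orderOf_eq_one_iff.1 h1))
  exact h (u ^ (orderOf u / ℓ)) (H.pow_mem hu _) ℓ hℓ (orderOf_pow_orderOf_div hord hdvd)

/-! ### §3 Selberg's lemma, neat form -/

section Selberg

variable {K : Type*} [Field K] {n : Type*} [Fintype n] [DecidableEq n]

/-- **Local step** ("the kernel `Γ₁` of `Γ → GL_n(k)` has finite index in `Γ` … does not have any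
torsion except possibly `p`-torsion", at the level of eigenvalue groups): for `Γ` inside the image
of `GL_n(A) → GL_n(K)` (`A ⊂ K` a domain) and a prime `P` of `A` with finite residue ring of
characteristic `p`, the kernel `Δ` of `Γ → GL_n(A/P)` has finite index and, for every `g ∈ Δ` and
every field `L ⊇ K`, every element of prime order `ℓ` of `E_L(g)` has `ℓ = p`.
[cite: Serre2007BoundsFiniteSubgroups, Lect. I §1.2, Remark (sketch of proof)]
[cite: Borel1969, §17 Prop. 17.7] -/
theorem exists_finiteIndex_forall_eigenvalueSubgroup_prime {A : Type*} [CommRing A] [IsDomain A]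
    {ι : A →+* K} (hι : Function.Injective ι) (Γ : Subgroup (GL n K))
    (hΓ : Γ ≤ (Matrix.GeneralLinearGroup.map (n := n) ι).range) (P : Ideal A) [P.IsPrime]
    [Finite (A ⧸ P)] :
    ∃ Δ : Subgroup Γ, Δ.FiniteIndex ∧ ∀ g ∈ Δ, ∀ (L : Type uL) [Field L] [Algebra K L],
      ∀ u ∈ eigenvalueSubgroup L ((g : GL n K) : Matrix n n K), ∀ ℓ : ℕ, ℓ.Prime →
        orderOf u = ℓ → ℓ = ringChar (A ⧸ P) := by
  classical
  -- `ρ : Γ → GL_n(A)`, the inverse of the injective `GL_n(A) → GL_n(K)` on `Γ`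
  have hinj : Function.Injective (Matrix.GeneralLinearGroup.map (n := n) ι) := by
    intro x y hxy
    apply Units.ext
    have h := congrArg (fun u : GL n K => (u : Matrix n n K)) hxy
    exact Matrix.map_injective hι (by simpa [Matrix.GeneralLinearGroup.map] using h)
  set e := MonoidHom.ofInjective hinj with he
  set ρ : Γ →* GL n A := e.symm.toMonoidHom.comp (Subgroup.inclusion hΓ) with hρ
  have hρ_spec : ∀ g : Γ, Matrix.GeneralLinearGroup.map ι (ρ g) = (g : GL n K) := fun g =>
    MonoidHom.apply_ofInjective_symm hinj (Subgroup.inclusion hΓ g)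
  -- reduction modulo `P`
  set π : GL n A →* GL n (A ⧸ P) := Matrix.GeneralLinearGroup.map (Ideal.Quotient.mk P) with hπ
  set f : Γ →* GL n (A ⧸ P) := π.comp ρ with hf
  haveI : Finite (GL n (A ⧸ P)) := by
    haveI : Finite (Matrix n n (A ⧸ P)) := Pi.finite
    infer_instance
  haveI : Finite f.range := inferInstance
  refine ⟨f.ker, inferInstance, fun g hg L _ _ u hu ℓ hℓ hord => ?_⟩
  -- `p = char (A/P)` is a prime in `P`
  set p := ringChar (A ⧸ P) with hp
  haveI hpP : CharP (A ⧸ P) p := ringChar.charP _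
  have hprime : p.Prime := CharP.prime_ringChar (A ⧸ P)
  have hpmem : (p : A) ∈ P := by
    rw [← Ideal.Quotient.eq_zero_iff_mem, map_natCast]
    exact CharP.cast_eq_zero (A ⧸ P) p
  -- `x = ρ g ≡ 1 (mod P)`
  have hker : π (ρ g) = 1 := by
    rw [← MonoidHom.comp_apply, ← hf]; exact (MonoidHom.mem_ker).mp hg
  have hxP : ∀ i j, (((ρ g : GL n A) : Matrix n n A) - 1) i j ∈ P := by
    have hmat : ((ρ g : GL n A) : Matrix n n A).map (Ideal.Quotient.mk P) = 1 := by
      have h := congrArg (fun u : GL n (A ⧸ P) => (u : Matrix n n (A ⧸ P))) hker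
      simpa [hπ, Matrix.GeneralLinearGroup.map] using h
    intro i j
    have h := congrFun (congrFun hmat i) j
    rw [Matrix.map_apply, Matrix.one_apply] at h
    rw [← Ideal.Quotient.eq_zero_iff_mem, Matrix.sub_apply, map_sub, h, Matrix.one_apply]
    split_ifs <;> simp
  -- the eigenvalue group of `g` over `K` is that of `x` over `A`
  letI : Algebra A L := ((algebraMap K L).comp ι).toAlgebra
  have hgx : ((g : GL n K) : Matrix n n K) = ((ρ g : GL n A) : Matrix n n A).map ι := by
    rw [← hρ_spec g]
    rfl
  have hE : eigenvalueSubgroup L ((g : GL n K) : Matrix n n K) =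
      eigenvalueSubgroup L ((ρ g : GL n A) : Matrix n n A) := by
    rw [hgx, eigenvalueSubgroup_map ι rfl]
  rw [hE] at hu
  have hinjAL : Function.Injective (algebraMap A L) := by
    intro a b hab
    exact hι ((algebraMap K L).injective hab)
  exact eq_of_orderOf_eq_prime_of_mem_eigenvalueSubgroup hinjAL P hprime hpmem hxP hu hℓ hord

variable [CharZero K]

/-- **Selberg's lemma, neat form (Borel 1969, Prop. 17.7), inside `Γ`**: a finitely generated
subgroup `Γ` of `GL_n(K)`, `K` a field of characteristic `0`, has a subgroup `Δ` of finite index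
all of whose elements are NEAT — with respect to every field `L ⊇ K` (e.g. `L = K̄`, the printed
notion): "if `K` is a field of characteristic zero and `H` is a finitely generated subgroup of
`GL_n(K)`, then `H` has a net (and therefore torsionfree) subgroup of finite index".
[cite: Borel1969, §17 Prop. 17.7] [cite: SilverbergZarhin1996, §1 p. 286]
[cite: Serre2007BoundsFiniteSubgroups, Lect. I §1.2, Remark (Malcev–Selberg)] -/
theorem Subgroup.exists_finiteIndex_neat_of_fg (Γ : Subgroup (GL n K)) (hΓ : Γ.FG) :
    ∃ Δ : Subgroup Γ, Δ.FiniteIndex ∧ ∀ (L : Type uL) [Field L] [Algebra K L],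
      ∀ g ∈ Δ, IsNeat L ((g : GL n K) : Matrix n n K) := by
  classical
  obtain ⟨L₀, hL₀fg, hΓL⟩ := exists_fg_subalgebra_le_range Γ hΓ
  haveI : Algebra.FiniteType ℤ L₀ := (Subalgebra.fg_iff_finiteType L₀).mp hL₀fg
  have hι : Function.Injective ((L₀.val : L₀ →ₐ[ℤ] K).toRingHom) := Subtype.val_injective
  -- "Let `𝔪` be a maximal ideal of `L₀`; the residue field is finite; let `p` be its characteristic."
  obtain ⟨M, hM⟩ := Ideal.exists_maximal L₀
  haveI : Finite (L₀ ⧸ M) := finite_quotient_of_isMaximal M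
  have hp : (ringChar (L₀ ⧸ M)).Prime := CharP.prime_ringChar (L₀ ⧸ M)
  obtain ⟨Δ₁, hΔ₁, h₁⟩ := exists_finiteIndex_forall_eigenvalueSubgroup_prime hι Γ hΓL M
  -- "By choosing another maximal ideal of `L₀`, with a different residue characteristic, …"
  obtain ⟨Q, hQ, hQfin, hQp⟩ := exists_ideal_isPrime_finite_quotient_ringChar_ne (A := L₀) hp
  haveI := hQ
  haveI := hQfin
  obtain ⟨Δ₂, hΔ₂, h₂⟩ := exists_finiteIndex_forall_eigenvalueSubgroup_prime hι Γ hΓL Q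
  refine ⟨Δ₁ ⊓ Δ₂, inferInstance, fun L _ _ g hg => ?_⟩
  -- an element of prime order `ℓ` of `E_L(g)` would have `ℓ = p` and `ℓ = q ≠ p`
  refine torsionFree_of_forall_orderOf_ne _ fun v hv ℓ hℓ hord => ?_
  have e₁ := h₁ g (Subgroup.mem_inf.mp hg).1 L v hv ℓ hℓ hord
  have e₂ := h₂ g (Subgroup.mem_inf.mp hg).2 L v hv ℓ hℓ hord
  exact hQp (e₂.symm.trans e₁)

/-- **Selberg's lemma, neat form**, `GL_n(K)`-level: a finitely generated `Γ ≤ GL_n(K)`,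
`char K = 0`, contains a subgroup `Δ ≤ Γ` of finite index in `Γ` which is NEAT (every element neat
with respect to every field `L ⊇ K`). [cite: Borel1969, §17 Prop. 17.7]
[cite: SilverbergZarhin1996, §1 p. 286] -/
theorem Subgroup.exists_le_finiteIndex_neat_of_fg (Γ : Subgroup (GL n K)) (hΓ : Γ.FG) :
    ∃ Δ : Subgroup (GL n K), Δ ≤ Γ ∧ (Δ.subgroupOf Γ).FiniteIndex ∧
      ∀ (L : Type uL) [Field L] [Algebra K L], ∀ g ∈ Δ, IsNeat L ((g : GL n K) : Matrix n n K) := by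
  obtain ⟨Δ, hΔ, hneat⟩ := Subgroup.exists_finiteIndex_neat_of_fg Γ hΓ
  refine ⟨Δ.map Γ.subtype, Subgroup.map_subtype_le Δ, ?_, ?_⟩
  · rw [← Subgroup.comap_subtype, Subgroup.comap_map_eq_self_of_injective Γ.subtype_injective]
    exact hΔ
  · rintro L _ _ _ ⟨g, hg, rfl⟩
    exact hneat L g hg

/-- **"Net, and therefore torsionfree"**: the neat subgroup of finite index is torsion-free
(`IsNeat.eq_one_of_pow_eq_one` with `L = K̄`), recovering the torsion-free form of Selberg's lemma
(`SelbergLemma`'s `Subgroup.exists_finiteIndex_torsionFree_of_fg`) from the neat form.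
[cite: SilverbergZarhin1996, §1 p. 286] [cite: Borel1969, §17 Prop. 17.7] -/
theorem Subgroup.exists_finiteIndex_neat_and_torsionFree_of_fg (Γ : Subgroup (GL n K))
    (hΓ : Γ.FG) :
    ∃ Δ : Subgroup Γ, Δ.FiniteIndex ∧
      (∀ g ∈ Δ, IsNeat (AlgebraicClosure K) ((g : GL n K) : Matrix n n K)) ∧
      ∀ g ∈ Δ, IsOfFinOrder g → g = 1 := by
  obtain ⟨Δ, hΔ, hneat⟩ := Subgroup.exists_finiteIndex_neat_of_fg Γ hΓ
  refine ⟨Δ, hΔ, hneat (AlgebraicClosure K), fun g hg hfin => ?_⟩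
  obtain ⟨k, hk, hgk⟩ := isOfFinOrder_iff_pow_eq_one.mp hfin
  have hgk' : (((g : GL n K) : Matrix n n K)) ^ k = 1 := by
    rw [← Units.val_pow_eq_pow_val, ← Subgroup.coe_pow, hgk, Subgroup.coe_one, Units.val_one]
  have h1 := (hneat (AlgebraicClosure K) g hg).eq_one_of_pow_eq_one
    (algebraMap K (AlgebraicClosure K)).injective hk hgk'
  exact Subtype.ext (Units.ext h1)

end Selberg

end Literature.GroupTheory.ArithmeticGroups
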